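import Mathlib
import Summits.NavierStokesRegularity.NavierStokesRegularity.Theorems.FilamentSkeletonRssKelvinGateSharpPicard
import Summits.NavierStokesRegularity.NavierStokesRegularity.Theorems.FilamentSkeletonRssKelvinGatePerturbation

/-!
# Route `FilamentSkeletonRss` · crux `TransverseReduction1A` (stmt-27414; successor of the aside `TransverseReductionRJ`,
# stmt-21221) — line `kelvin_gate`: a Kelvin gate SURVIVES A SMALL CHANGE OF THE BASE (Neumann iteration in the sharp scales)

Helper file (theorems only, `--as helper`).  HONEST FRAMING: analysis bookkeeping for a HYPOTHETICAL filament-type rotating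
self-similar blow-up route; nothing here bears on Navier–Stokes regularity; no stub is proved here.

The linearised profile operator at the base `U⁰ + V` is `𝓛_(α,U⁰+V) W = 𝓛_(α,U⁰) W + (DW[V] + DV[W])` and the perturbation maps
`X♯_a → Y♯_a` with norm `≤ 4M` when `⟨y⟩‖V‖, ⟨y⟩²‖DV‖, ⟨y⟩³‖D²V‖ ≤ M` (`XSharp.ySharp_perturbation`).  Hence a gate `K` at `U⁰`
(operator bound `YSharp a F R → XSharp a (K F) (A R)`, linear) yields a solution of the gate equation at `U⁰ + V` by the fixed point
`F = r − (D(KF)[V] + DV[KF])`, `W = K F`, as soon as `8 A M ≤ 1`.  This file runs that iteration (same skeleton as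
`…KelvinGateSharpPicard`, linear map instead of quadratic):

* `gatePerturb_maps_ball`, `gatePerturb_sub_eq`, `gatePerturb_contracts`, `gatePerturb_seq_bounds`;
* `gatePerturb_exists_fixedPoint` — **∃ F, `YSharp a F (2ε)` ∧ `F = r − (D(KF)[V] + DV[KF])`** (so `X♯(KF) ≤ 2Aε`: the perturbed gate has
  bound `2A`);
* `gatePerturb_unique` — two fixed points with sharp-Y bounds coincide (contraction), the input for linearity of the perturbed gate;
* `small_base_gate` — instantiation `U⁰ = 0`, `K :=` the free sharp gate: **for every rate `α` and every `C²` base `V` with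
  `8 C(a) M ≤ 1` the gate equation `𝓛_(α,V) W + ∇Q = r` is solvable in `X♯_a × C¹` for all `r ∈ Y♯_a`, with `X♯(W) ≤ 2C Y♯(r)`, `div W = 0`.**
What is NOT here: large bases (the crux: compactness + Kelvin modes + free rate).
-/

set_option linter.dupNamespace false

noncomputable section

namespace Summit.NavierStokesRegularity.NavierStokesRegularity.Theorems.KelvinGate

open Set Function Filter MeasureTheory
open Literature.Analysis.FluidPDE Literature.Analysis.FluidPDE.NewtonPotentialHolder Literature.Analysis.UnboundedOperators
open scoped InnerProductSpace Laplacian ContDiff Topology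

/-! ## The Neumann/Picard iteration for a perturbed base -/

section GatePerturb

variable {a : ℝ} {K : (EuclideanSpace ℝ (Fin 3) → EuclideanSpace ℝ (Fin 3)) →
    EuclideanSpace ℝ (Fin 3) → EuclideanSpace ℝ (Fin 3)} {A M ε : ℝ}
  {r V : EuclideanSpace ℝ (Fin 3) → EuclideanSpace ℝ (Fin 3)}

/-- **The perturbation map preserves the ball `Y♯ ≤ 2ε`.**  With the operator bound `Y♯(F) ≤ R ⇒ X♯(K F) ≤ A R`, a datum
`r` with `Y♯(r) ≤ ε` and a base perturbation `V` of size `M` (`⟨y⟩‖V‖, ⟨y⟩²‖DV‖, ⟨y⟩³‖D²V‖ ≤ M`): if `8 A M ≤ 1` then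
`Y♯(F) ≤ 2ε ⇒ Y♯(r − (D(KF)[V] + DV[KF])) ≤ 2ε` (indeed `≤ ε + 4M·2Aε ≤ 2ε`). -/
theorem gatePerturb_maps_ball
    (hK1 : ∀ (F : EuclideanSpace ℝ (Fin 3) → EuclideanSpace ℝ (Fin 3)) (R : ℝ), YSharp a F R → XSharp a (K F) (A * R))
    (hr : YSharp a r ε) (ha2 : a ≤ 2) (hV : ContDiff ℝ 2 V) (hV0 : ∀ y, (1 + ‖y‖) * ‖V y‖ ≤ M)
    (hV1 : ∀ y, (1 + ‖y‖) ^ 2 * ‖fderiv ℝ V y‖ ≤ M) (hV2 : ∀ y, (1 + ‖y‖) ^ 3 * ‖fderiv ℝ (fderiv ℝ V) y‖ ≤ M)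
    (hAM : 8 * A * M ≤ 1)
    {F : EuclideanSpace ℝ (Fin 3) → EuclideanSpace ℝ (Fin 3)} (hF : YSharp a F (2 * ε)) :
    YSharp a (fun y => r y - (fderiv ℝ (K F) y (V y) + fderiv ℝ V y (K F y))) (2 * ε) := by
  have hε : 0 ≤ ε := hr.nonneg
  have hW : XSharp a (K F) (A * (2 * ε)) := hK1 F _ hF
  have hB : YSharp a (fun y => fderiv ℝ (K F) y (V y) + fderiv ℝ V y (K F y)) (4 * M * (A * (2 * ε))) :=
    hW.ySharp_perturbation ha2 hV hV0 hV1 hV2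
  have h := hr.sub hB
  refine h.mono ?_
  nlinarith [hAM, hε]

/-- **Pointwise form of the difference of two images.**  For sharp-Y-bounded `F, G` with `H := K (F − G)` (X♯-field):
`Ψ F y − Ψ G y = −(DH(y)[V y] + DV(y)[H y])` (linearity of `K` and of the perturbation term). -/
theorem gatePerturb_sub_eq
    (hK1 : ∀ (F : EuclideanSpace ℝ (Fin 3) → EuclideanSpace ℝ (Fin 3)) (R : ℝ), YSharp a F R → XSharp a (K F) (A * R))
    (hK2 : ∀ (F G : EuclideanSpace ℝ (Fin 3) → EuclideanSpace ℝ (Fin 3)) (s : ℝ), (∃ R, YSharp a F R) →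
      (∃ R, YSharp a G R) → K (fun y => F y + s • G y) = fun y => K F y + s • K G y)
    {F G : EuclideanSpace ℝ (Fin 3) → EuclideanSpace ℝ (Fin 3)} {R S : ℝ} (hF : YSharp a F R) (hG : YSharp a G S)
    (y : EuclideanSpace ℝ (Fin 3)) :
    (r y - (fderiv ℝ (K F) y (V y) + fderiv ℝ V y (K F y))) - (r y - (fderiv ℝ (K G) y (V y) + fderiv ℝ V y (K G y))) =
      -(fderiv ℝ (K (fun z => F z - G z)) y (V y) + fderiv ℝ V y (K (fun z => F z - G z) y)) := by
  have hsub := sharp_picard_K_sub hK2 hF hG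
  have hKG : XSharp a (K G) (A * S) := hK1 G _ hG
  have hH : XSharp a (K (fun z => F z - G z)) (A * (R + S)) := hK1 _ _ (hF.sub hG)
  have eKF : K F = fun z => K G z + K (fun z => F z - G z) z := funext hsub
  have hdG : DifferentiableAt ℝ (K G) y := hKG.1.differentiable (by norm_num) y
  have hdH : DifferentiableAt ℝ (K (fun z => F z - G z)) y := hH.1.differentiable (by norm_num) y
  have eD : fderiv ℝ (K F) y = fderiv ℝ (K G) y + fderiv ℝ (K (fun z => F z - G z)) y := by
    rw [eKF]; exact fderiv_fun_add hdG hdH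
  rw [eD, _root_.add_apply, hsub y, map_add]
  abel

/-- **The perturbation map halves Y♯-distances** (when `8 A M ≤ 1`): `Y♯(F − G) ≤ d ⇒ Y♯(Ψ F − Ψ G) ≤ d/2`
(indeed `≤ 4M·A·d`). -/
theorem gatePerturb_contracts
    (hK1 : ∀ (F : EuclideanSpace ℝ (Fin 3) → EuclideanSpace ℝ (Fin 3)) (R : ℝ), YSharp a F R → XSharp a (K F) (A * R))
    (hK2 : ∀ (F G : EuclideanSpace ℝ (Fin 3) → EuclideanSpace ℝ (Fin 3)) (s : ℝ), (∃ R, YSharp a F R) →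
      (∃ R, YSharp a G R) → K (fun y => F y + s • G y) = fun y => K F y + s • K G y)
    (ha2 : a ≤ 2) (hV : ContDiff ℝ 2 V) (hV0 : ∀ y, (1 + ‖y‖) * ‖V y‖ ≤ M)
    (hV1 : ∀ y, (1 + ‖y‖) ^ 2 * ‖fderiv ℝ V y‖ ≤ M) (hV2 : ∀ y, (1 + ‖y‖) ^ 3 * ‖fderiv ℝ (fderiv ℝ V) y‖ ≤ M)
    (hAM : 8 * A * M ≤ 1)
    {F G : EuclideanSpace ℝ (Fin 3) → EuclideanSpace ℝ (Fin 3)} {R₁ S₁ : ℝ} (hF : YSharp a F R₁) (hG : YSharp a G S₁)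
    {d : ℝ} (hFG : YSharp a (fun y => F y - G y) d) :
    YSharp a (fun y => (r y - (fderiv ℝ (K F) y (V y) + fderiv ℝ V y (K F y))) -
      (r y - (fderiv ℝ (K G) y (V y) + fderiv ℝ V y (K G y)))) (d / 2) := by
  have hd : 0 ≤ d := hFG.nonneg
  have hH : XSharp a (K (fun z => F z - G z)) (A * d) := hK1 _ _ hFG
  have h1 : YSharp a (fun y => fderiv ℝ (K (fun z => F z - G z)) y (V y) + fderiv ℝ V y (K (fun z => F z - G z) y))
      (4 * M * (A * d)) := hH.ySharp_perturbation ha2 hV hV0 hV1 hV2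
  have h := h1.neg
  have e : (fun y => (r y - (fderiv ℝ (K F) y (V y) + fderiv ℝ V y (K F y))) -
      (r y - (fderiv ℝ (K G) y (V y) + fderiv ℝ V y (K G y)))) =
      fun y => -(fderiv ℝ (K (fun z => F z - G z)) y (V y) + fderiv ℝ V y (K (fun z => F z - G z) y)) :=
    funext (gatePerturb_sub_eq hK1 hK2 hF hG)
  rw [e]
  refine h.mono ?_
  nlinarith [hAM, hd]

/-- **The iterates** `F₀ = 0`, `F_{n+1} = Ψ F_n` stay in the ball `Y♯ ≤ 2ε` and have geometrically decreasing increments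
`Y♯(F_{n+1} − F_n) ≤ 2ε / 2^n`.  (Stated for any sequence satisfying the recursion.) -/
theorem gatePerturb_seq_bounds
    (hK1 : ∀ (F : EuclideanSpace ℝ (Fin 3) → EuclideanSpace ℝ (Fin 3)) (R : ℝ), YSharp a F R → XSharp a (K F) (A * R))
    (hK2 : ∀ (F G : EuclideanSpace ℝ (Fin 3) → EuclideanSpace ℝ (Fin 3)) (s : ℝ), (∃ R, YSharp a F R) →
      (∃ R, YSharp a G R) → K (fun y => F y + s • G y) = fun y => K F y + s • K G y)
    (hr : YSharp a r ε) (ha2 : a ≤ 2) (hV : ContDiff ℝ 2 V) (hV0 : ∀ y, (1 + ‖y‖) * ‖V y‖ ≤ M)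
    (hV1 : ∀ y, (1 + ‖y‖) ^ 2 * ‖fderiv ℝ V y‖ ≤ M) (hV2 : ∀ y, (1 + ‖y‖) ^ 3 * ‖fderiv ℝ (fderiv ℝ V) y‖ ≤ M)
    (hAM : 8 * A * M ≤ 1)
    {Fs : ℕ → EuclideanSpace ℝ (Fin 3) → EuclideanSpace ℝ (Fin 3)} (h0 : Fs 0 = fun _ => 0)
    (hsucc : ∀ n, Fs (n + 1) = fun y => r y - (fderiv ℝ (K (Fs n)) y (V y) + fderiv ℝ V y (K (Fs n) y))) (n : ℕ) :
    YSharp a (Fs n) (2 * ε) ∧ YSharp a (fun y => Fs (n + 1) y - Fs n y) (2 * ε / 2 ^ n) := by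
  have hε : 0 ≤ ε := hr.nonneg
  induction n with
  | zero =>
    have hz : YSharp a (fun _ : EuclideanSpace ℝ (Fin 3) => (0 : EuclideanSpace ℝ (Fin 3))) (2 * ε) :=
      ySharp_zero.mono (by linarith)
    rw [h0]
    refine ⟨hz, ?_⟩
    have h1 := gatePerturb_maps_ball hK1 hr ha2 hV hV0 hV1 hV2 hAM hz
    rw [hsucc 0, h0]
    simpa using h1
  | succ n ih =>
    obtain ⟨hn, hdn⟩ := ih
    have hn1 : YSharp a (Fs (n + 1)) (2 * ε) := by
      rw [hsucc n]
      exact gatePerturb_maps_ball hK1 hr ha2 hV hV0 hV1 hV2 hAM hn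
    refine ⟨hn1, ?_⟩
    have h := gatePerturb_contracts (r := r) hK1 hK2 ha2 hV hV0 hV1 hV2 hAM hn1 hn hdn
    have e : (fun y => Fs (n + 1 + 1) y - Fs (n + 1) y) =
        fun y => (r y - (fderiv ℝ (K (Fs (n + 1))) y (V y) + fderiv ℝ V y (K (Fs (n + 1)) y))) -
          (r y - (fderiv ℝ (K (Fs n)) y (V y) + fderiv ℝ V y (K (Fs n) y))) := by
      funext y
      have e1 := congrFun (hsucc (n + 1)) y
      have e2 := congrFun (hsucc n) y
      rw [e1, e2]
    rw [e]
    refine h.mono (le_of_eq ?_)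
    rw [pow_succ]
    ring

/-- **Existence of the fixed point of the perturbation map.**  Under the operator bound `Y♯(F) ≤ R ⇒ X♯(K F) ≤ A R`,
linearity of `K` on sharp-Y-bounded data, a datum `r` with `Y♯(r) ≤ ε`, a base perturbation `V` of size `M` and `8 A M ≤ 1`, there is
`F` with `Y♯(F) ≤ 2ε` and `F(y) = r(y) − (D(KF)(y)[V(y)] + DV(y)[KF(y)])` for every `y` — so that `W := K F` solves
`(𝓛_(α,U⁰) + DW[V] + DV[W]) + ∇Q = r`, i.e. the gate equation at the base `U⁰ + V`, whenever `K` is a gate at `U⁰`. -/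
theorem gatePerturb_exists_fixedPoint (ha : 1 ≤ a)
    (hK1 : ∀ (F : EuclideanSpace ℝ (Fin 3) → EuclideanSpace ℝ (Fin 3)) (R : ℝ), YSharp a F R → XSharp a (K F) (A * R))
    (hK2 : ∀ (F G : EuclideanSpace ℝ (Fin 3) → EuclideanSpace ℝ (Fin 3)) (s : ℝ), (∃ R, YSharp a F R) →
      (∃ R, YSharp a G R) → K (fun y => F y + s • G y) = fun y => K F y + s • K G y)
    (hr : YSharp a r ε) (ha2 : a ≤ 2) (hV : ContDiff ℝ 2 V) (hV0 : ∀ y, (1 + ‖y‖) * ‖V y‖ ≤ M)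
    (hV1 : ∀ y, (1 + ‖y‖) ^ 2 * ‖fderiv ℝ V y‖ ≤ M) (hV2 : ∀ y, (1 + ‖y‖) ^ 3 * ‖fderiv ℝ (fderiv ℝ V) y‖ ≤ M)
    (hAM : 8 * A * M ≤ 1) :
    ∃ F : EuclideanSpace ℝ (Fin 3) → EuclideanSpace ℝ (Fin 3),
      YSharp a F (2 * ε) ∧ ∀ y, F y = r y - (fderiv ℝ (K F) y (V y) + fderiv ℝ V y (K F y)) := by
  have hε : 0 ≤ ε := hr.nonneg
  -- the Picard sequence
  obtain ⟨Fs, h0, hsucc⟩ : ∃ Fs : ℕ → EuclideanSpace ℝ (Fin 3) → EuclideanSpace ℝ (Fin 3), (Fs 0 = fun _ => 0) ∧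
      ∀ n, Fs (n + 1) = fun y => r y - (fderiv ℝ (K (Fs n)) y (V y) + fderiv ℝ V y (K (Fs n) y)) :=
    ⟨fun n => (fun F => fun y => r y - (fderiv ℝ (K F) y (V y) + fderiv ℝ V y (K F y)))^[n] (fun _ => 0), rfl,
      fun n => Function.iterate_succ_apply' _ n _⟩
  have hb := fun n => gatePerturb_seq_bounds hK1 hK2 hr ha2 hV hV0 hV1 hV2 hAM h0 hsucc n
  have hC1s : ∀ n, ContDiff ℝ 1 (Fs n) := fun n => (hb n).1.1
  have hdiff : ∀ n y, DifferentiableAt ℝ (Fs n) y := fun n y => (hC1s n).differentiable (by norm_num) y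
  have h2n : ∀ n : ℕ, (2:ℝ) * ε / 2 ^ n = 2 * ε * (1 / 2) ^ n := fun n => by
    rw [one_div, inv_pow, div_eq_mul_inv]
  -- weighted geometric increments, for the fields and for their derivatives
  have hdist : ∀ y n, dist (Fs n y) (Fs (n + 1) y) ≤ 2 * ε / (1 + ‖y‖) ^ (a + 1) * (1 / 2) ^ n := by
    intro y n
    rw [dist_comm, dist_eq_norm]
    have h := (hb n).2.norm_le y
    rw [h2n] at h
    calc ‖Fs (n + 1) y - Fs n y‖ ≤ 2 * ε * (1 / 2) ^ n / (1 + ‖y‖) ^ (a + 1) := h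
      _ = 2 * ε / (1 + ‖y‖) ^ (a + 1) * (1 / 2) ^ n := by ring
  have hdistD : ∀ y n, dist (fderiv ℝ (Fs n) y) (fderiv ℝ (Fs (n + 1)) y) ≤
      2 * ε / (1 + ‖y‖) ^ (a + 1) * (1 / 2) ^ n := by
    intro y n
    rw [dist_comm, dist_eq_norm]
    have h := ((hb n).2.2 y).2
    rw [fderiv_fun_sub (hdiff (n + 1) y) (hdiff n y), h2n] at h
    have e : 2 * ε / (1 + ‖y‖) ^ (a + 1) * (1 / 2 : ℝ) ^ n = 2 * ε * (1 / 2) ^ n / (1 + ‖y‖) ^ (a + 1) := by ring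
    rw [e, le_div_iff₀ (by positivity)]
    calc ‖fderiv ℝ (Fs (n + 1)) y - fderiv ℝ (Fs n) y‖ * (1 + ‖y‖) ^ (a + 1)
        = (1 + ‖y‖) ^ (a + 1) * ‖fderiv ℝ (Fs (n + 1)) y - fderiv ℝ (Fs n) y‖ := by ring
      _ ≤ 2 * ε * (1 / 2) ^ n := h
  -- pointwise limits (values in `ℝ³`, derivatives in `ℝ³ →L ℝ³`; both complete)
  have hlimF : ∀ y, ∃ v, Tendsto (fun n => Fs n y) atTop (𝓝 v) := fun y =>
    cauchySeq_tendsto_of_complete (cauchySeq_of_le_geometric (1 / 2) _ (by norm_num) (hdist y))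
  have hlimD : ∀ y, ∃ L, Tendsto (fun n => fderiv ℝ (Fs n) y) atTop (𝓝 L) := fun y =>
    cauchySeq_tendsto_of_complete (cauchySeq_of_le_geometric (1 / 2) _ (by norm_num) (hdistD y))
  choose Flim hFlim using hlimF
  choose Glim hGlim using hlimD
  -- geometric tails
  have htail : ∀ y n, dist (Fs n y) (Flim y) ≤ 4 * ε / (1 + ‖y‖) ^ (a + 1) * (1 / 2) ^ n := by
    intro y n
    have h := dist_le_of_le_geometric_of_tendsto (1 / 2) _ (by norm_num) (hdist y) (hFlim y) n
    calc dist (Fs n y) (Flim y) ≤ 2 * ε / (1 + ‖y‖) ^ (a + 1) * (1 / 2) ^ n / (1 - 1 / 2) := h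
      _ = 4 * ε / (1 + ‖y‖) ^ (a + 1) * (1 / 2) ^ n := by ring
  have htailD : ∀ y n, dist (fderiv ℝ (Fs n) y) (Glim y) ≤ 4 * ε / (1 + ‖y‖) ^ (a + 1) * (1 / 2) ^ n := by
    intro y n
    have h := dist_le_of_le_geometric_of_tendsto (1 / 2) _ (by norm_num) (hdistD y) (hGlim y) n
    calc dist (fderiv ℝ (Fs n) y) (Glim y) ≤ 2 * ε / (1 + ‖y‖) ^ (a + 1) * (1 / 2) ^ n / (1 - 1 / 2) := h
      _ = 4 * ε / (1 + ‖y‖) ^ (a + 1) * (1 / 2) ^ n := by ring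
  -- the derivatives converge uniformly (the weight is `≥ 1`)
  have hpow0 : Tendsto (fun n : ℕ => 4 * ε * (1 / 2 : ℝ) ^ n) atTop (𝓝 0) := by
    have h := (tendsto_pow_atTop_nhds_zero_of_lt_one (by norm_num : (0:ℝ) ≤ 1 / 2)
      (by norm_num : (1 / 2 : ℝ) < 1)).const_mul (4 * ε)
    rwa [mul_zero] at h
  have hunif : TendstoUniformly (fun n y => fderiv ℝ (Fs n) y) Glim atTop := by
    rw [Metric.tendstoUniformly_iff]
    intro δ hδ
    filter_upwards [(hpow0.eventually (gt_mem_nhds hδ))] with n hn y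
    rw [dist_comm]
    have hw : (1:ℝ) ≤ (1 + ‖y‖) ^ (a + 1) := Real.one_le_rpow (by linarith [norm_nonneg y]) (by linarith)
    calc dist (fderiv ℝ (Fs n) y) (Glim y) ≤ 4 * ε / (1 + ‖y‖) ^ (a + 1) * (1 / 2) ^ n := htailD y n
      _ ≤ 4 * ε / 1 * (1 / 2) ^ n := by
          gcongr
      _ = 4 * ε * (1 / 2) ^ n := by ring
      _ < δ := hn
  -- the limit is `C¹` with derivative `Glim`
  have hderiv : ∀ y, HasFDerivAt Flim (Glim y) y :=
    hasFDerivAt_of_tendstoUniformly hunif (fun n y => (hdiff n y).hasFDerivAt) hFlim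
  have hfd : fderiv ℝ Flim = Glim := funext fun y => (hderiv y).fderiv
  have hC1 : ContDiff ℝ 1 Flim := by
    rw [contDiff_one_iff_fderiv]
    refine ⟨fun y => (hderiv y).differentiableAt, ?_⟩
    rw [hfd]
    exact hunif.continuous (Eventually.of_forall fun n => (hC1s n).continuous_fderiv one_ne_zero).frequently
  -- weighted bounds pass to the limit: `Y(Flim) ≤ 2ε` and `Y(Fs n − Flim) ≤ 4ε (1/2)^n`
  have hYlim : YSharp a Flim (2 * ε) := by
    refine ⟨hC1, fun y => ⟨?_, ?_⟩⟩
    · refine le_of_tendsto ((hFlim y).norm.const_mul ((1 + ‖y‖) ^ (a + 1))) (Eventually.of_forall fun n => ?_)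
      exact ((hb n).1.2 y).1
    · rw [hfd]
      refine le_of_tendsto ((hGlim y).norm.const_mul ((1 + ‖y‖) ^ (a + 1))) (Eventually.of_forall fun n => ?_)
      exact ((hb n).1.2 y).2
  have hYdiff : ∀ n, YSharp a (fun y => Fs n y - Flim y) (4 * ε * (1 / 2) ^ n) := by
    intro n
    refine ⟨(hC1s n).sub hC1, fun y => ⟨?_, ?_⟩⟩
    · calc (1 + ‖y‖) ^ (a + 1) * ‖Fs n y - Flim y‖ = dist (Fs n y) (Flim y) * (1 + ‖y‖) ^ (a + 1) := by
            rw [dist_eq_norm]; ring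
        _ ≤ 4 * ε / (1 + ‖y‖) ^ (a + 1) * (1 / 2) ^ n * (1 + ‖y‖) ^ (a + 1) :=
            mul_le_mul_of_nonneg_right (htail y n) (by positivity)
        _ = 4 * ε * (1 / 2) ^ n := by field_simp
    · rw [fderiv_fun_sub (hdiff n y) ((hderiv y).differentiableAt), hfd]
      calc (1 + ‖y‖) ^ (a + 1) * ‖fderiv ℝ (Fs n) y - Glim y‖ = dist (fderiv ℝ (Fs n) y) (Glim y) * (1 + ‖y‖) ^ (a + 1) := by
            rw [dist_eq_norm]; ring
        _ ≤ 4 * ε / (1 + ‖y‖) ^ (a + 1) * (1 / 2) ^ n * (1 + ‖y‖) ^ (a + 1) :=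
            mul_le_mul_of_nonneg_right (htailD y n) (by positivity)
        _ = 4 * ε * (1 / 2) ^ n := by field_simp
  -- the fixed-point identity: pass to the limit in `F_{n+1} = Φ F_n`
  refine ⟨Flim, hYlim, fun y => ?_⟩
  have hKlim : XSharp a (K Flim) (A * (2 * ε)) := hK1 _ _ hYlim
  have hA0 : 0 ≤ A := by
    have h := (hK1 _ _ (ySharp_zero.mono (zero_le_one))).nonneg
    linarith
  -- `K (Fs n) = K Flim + H n` with `H n := K (Fs n − Flim)` X-small
  have hH : ∀ n, XSharp a (K (fun z => Fs n z - Flim z)) (A * (4 * ε * (1 / 2) ^ n)) := fun n => hK1 _ _ (hYdiff n)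
  have hsplit : ∀ n, K (Fs n) y = K Flim y + K (fun z => Fs n z - Flim z) y := fun n =>
    sharp_picard_K_sub hK2 (hb n).1 hYlim y
  have hsplitD : ∀ n, fderiv ℝ (K (Fs n)) y = fderiv ℝ (K Flim) y + fderiv ℝ (K (fun z => Fs n z - Flim z)) y := by
    intro n
    have e : K (Fs n) = fun z => K Flim z + K (fun z => Fs n z - Flim z) z :=
      funext (sharp_picard_K_sub hK2 (hb n).1 hYlim)
    rw [e]
    exact fderiv_fun_add (hKlim.1.differentiable (by norm_num) y) ((hH n).1.differentiable (by norm_num) y)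
  have hApow : Tendsto (fun n : ℕ => A * (4 * ε * (1 / 2 : ℝ) ^ n)) atTop (𝓝 0) := by
    have h := hpow0.const_mul A
    rwa [mul_zero] at h
  have hHv : Tendsto (fun n => K (fun z => Fs n z - Flim z) y) atTop (𝓝 0) := by
    rw [tendsto_zero_iff_norm_tendsto_zero]
    exact squeeze_zero (fun n => norm_nonneg _) (fun n => ((hH n).norm_le' (by linarith) y).1) hApow
  have hHD : Tendsto (fun n => fderiv ℝ (K (fun z => Fs n z - Flim z)) y) atTop (𝓝 0) := by
    rw [tendsto_zero_iff_norm_tendsto_zero]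
    exact squeeze_zero (fun n => norm_nonneg _) (fun n => ((hH n).norm_le' (by linarith) y).2) hApow
  have hv : Tendsto (fun n => K (Fs n) y) atTop (𝓝 (K Flim y)) := by
    have h := (tendsto_const_nhds (x := K Flim y)).add hHv
    rw [add_zero] at h
    exact h.congr fun n => (hsplit n).symm
  have hL : Tendsto (fun n => fderiv ℝ (K (Fs n)) y) atTop (𝓝 (fderiv ℝ (K Flim) y)) := by
    have h := (tendsto_const_nhds (x := fderiv ℝ (K Flim) y)).add hHD
    rw [add_zero] at h
    exact h.congr fun n => (hsplitD n).symm
  have happ : Tendsto (fun n => fderiv ℝ (K (Fs n)) y (V y) + fderiv ℝ V y (K (Fs n) y)) atTop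
      (𝓝 (fderiv ℝ (K Flim) y (V y) + fderiv ℝ V y (K Flim y))) :=
    ((ContinuousLinearMap.apply ℝ (EuclideanSpace ℝ (Fin 3)) (V y)).continuous.tendsto _ |>.comp hL).add
      ((fderiv ℝ V y).continuous.tendsto _ |>.comp hv)
  have hrhs : Tendsto (fun n => r y - (fderiv ℝ (K (Fs n)) y (V y) + fderiv ℝ V y (K (Fs n) y))) atTop
      (𝓝 (r y - (fderiv ℝ (K Flim) y (V y) + fderiv ℝ V y (K Flim y)))) := tendsto_const_nhds.sub happ
  have hlhs : Tendsto (fun n => Fs (n + 1) y) atTop (𝓝 (Flim y)) := (hFlim y).comp (tendsto_add_atTop_nat 1)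
  have heq : (fun n => Fs (n + 1) y) = fun n => r y - (fderiv ℝ (K (Fs n)) y (V y) + fderiv ℝ V y (K (Fs n) y)) :=
    funext fun n => congrFun (hsucc n) y
  rw [heq] at hlhs
  exact tendsto_nhds_unique hlhs hrhs



/-- **Uniqueness of the fixed point** (contraction): two sharp-Y-bounded solutions of `F = r − (D(KF)[V] + DV[KF])` coincide. -/
theorem gatePerturb_unique (ha : 1 ≤ a)
    (hK1 : ∀ (F : EuclideanSpace ℝ (Fin 3) → EuclideanSpace ℝ (Fin 3)) (R : ℝ), YSharp a F R → XSharp a (K F) (A * R))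
    (hK2 : ∀ (F G : EuclideanSpace ℝ (Fin 3) → EuclideanSpace ℝ (Fin 3)) (s : ℝ), (∃ R, YSharp a F R) →
      (∃ R, YSharp a G R) → K (fun y => F y + s • G y) = fun y => K F y + s • K G y)
    (ha2 : a ≤ 2) (hV : ContDiff ℝ 2 V) (hV0 : ∀ y, (1 + ‖y‖) * ‖V y‖ ≤ M)
    (hV1 : ∀ y, (1 + ‖y‖) ^ 2 * ‖fderiv ℝ V y‖ ≤ M) (hV2 : ∀ y, (1 + ‖y‖) ^ 3 * ‖fderiv ℝ (fderiv ℝ V) y‖ ≤ M)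
    (hAM : 8 * A * M ≤ 1)
    {F G : EuclideanSpace ℝ (Fin 3) → EuclideanSpace ℝ (Fin 3)} {R₁ S₁ : ℝ} (hF : YSharp a F R₁) (hG : YSharp a G S₁)
    (hFfix : ∀ y, F y = r y - (fderiv ℝ (K F) y (V y) + fderiv ℝ V y (K F y)))
    (hGfix : ∀ y, G y = r y - (fderiv ℝ (K G) y (V y) + fderiv ℝ V y (K G y))) : F = G := by
  -- `Y♯(F − G) ≤ (R₁+S₁)/2^n` for every `n`
  have hiter : ∀ n : ℕ, YSharp a (fun y => F y - G y) ((R₁ + S₁) / 2 ^ n) := by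
    intro n
    induction n with
    | zero => simpa using hF.sub hG
    | succ n ih =>
      have h := gatePerturb_contracts (r := r) hK1 hK2 ha2 hV hV0 hV1 hV2 hAM hF hG ih
      have e : (fun y => (r y - (fderiv ℝ (K F) y (V y) + fderiv ℝ V y (K F y))) -
          (r y - (fderiv ℝ (K G) y (V y) + fderiv ℝ V y (K G y)))) = fun y => F y - G y := by
        funext y; rw [← hFfix y, ← hGfix y]
      rw [e] at h
      refine h.mono (le_of_eq ?_)
      rw [pow_succ]; ring
  funext y
  have hRS : 0 ≤ R₁ + S₁ := add_nonneg hF.nonneg hG.nonneg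
  have hlim : Tendsto (fun n : ℕ => (R₁ + S₁) / 2 ^ n) atTop (𝓝 0) := by
    have h := (tendsto_pow_atTop_nhds_zero_of_lt_one (by norm_num : (0:ℝ) ≤ 1 / 2)
      (by norm_num : (1 / 2 : ℝ) < 1)).const_mul (R₁ + S₁)
    rw [mul_zero] at h
    refine h.congr fun n => ?_
    rw [one_div, inv_pow, div_eq_mul_inv]
  have hle : ∀ n : ℕ, ‖F y - G y‖ ≤ (R₁ + S₁) / 2 ^ n := fun n => ((hiter n).norm_le' (by linarith) y).1
  have h0 : ‖F y - G y‖ ≤ 0 := ge_of_tendsto' hlim hle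
  exact sub_eq_zero.1 (norm_le_zero_iff.1 h0)

end GatePerturb

/-! ## The Kelvin gate at every small decaying base -/

/-- **THE KELVIN GATE AT A SMALL BASE.**  For `1 < a < 2` there is `C ≥ 0` (the free-gate constant) such that for every rate `α`,
every `C²` base `V` with `⟨y⟩‖V‖, ⟨y⟩²‖DV‖, ⟨y⟩³‖D²V‖ ≤ M` and `8 C M ≤ 1`, and every forcing with `YSharp a r ε`, there are
`W ∈ C²` with `XSharp a W (2Cε)`, `div W = 0`, and `Q ∈ C¹`, `|Q| ≤ 2Cε`, solving the gate equation AT THE BASE `V`: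
`𝓛_(α,V) W + ∇Q = r` pointwise. -/
theorem small_base_gate {a : ℝ} (ha1 : 1 < a) (ha2 : a < 2) :
    ∃ C : ℝ, 0 ≤ C ∧ ∀ (α : ℝ) (V : EuclideanSpace ℝ (Fin 3) → EuclideanSpace ℝ (Fin 3)) (M : ℝ), ContDiff ℝ 2 V →
      (∀ y, (1 + ‖y‖) * ‖V y‖ ≤ M) → (∀ y, (1 + ‖y‖) ^ 2 * ‖fderiv ℝ V y‖ ≤ M) →
      (∀ y, (1 + ‖y‖) ^ 3 * ‖fderiv ℝ (fderiv ℝ V) y‖ ≤ M) → 8 * C * M ≤ 1 →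
      ∀ (r : EuclideanSpace ℝ (Fin 3) → EuclideanSpace ℝ (Fin 3)) (ε : ℝ), YSharp a r ε →
      ∃ (W : EuclideanSpace ℝ (Fin 3) → EuclideanSpace ℝ (Fin 3)) (Q : EuclideanSpace ℝ (Fin 3) → ℝ),
        XSharp a W (2 * C * ε) ∧ ContDiff ℝ 1 Q ∧ VectorCalculus.IsDivFree W ∧ (∀ y, |Q y| ≤ 2 * C * ε) ∧
        ∀ y, lerayLin α V W y + gradient Q y = r y := by
  obtain ⟨C, hC0, hgate⟩ := free_kelvin_gate_ySharp ha1 ha2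
  refine ⟨C, hC0, ?_⟩
  intro α V M hV hV0 hV1 hV2 hCM r ε hr
  -- the free gate as an operator `K`
  obtain ⟨K, hK⟩ : ∃ K : (EuclideanSpace ℝ (Fin 3) → EuclideanSpace ℝ (Fin 3)) → EuclideanSpace ℝ (Fin 3) →
      EuclideanSpace ℝ (Fin 3), ∀ F, K F = fun y => ∫ s in Ioi (0:ℝ), (Real.exp (-(s / 2)) • rotZL (-(α * s)))
      (heatExtension (fun x => F x - gradient (fun x => ∑ j : Fin 3,
        newtonGradPotential (EuclideanSpace.single j (1:ℝ)) (fun y => F y j) x) x)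
        (1 - Real.exp (-s)) ((Real.exp (-(s / 2)) • rotZL (α * s)) y)) := ⟨_, fun F => rfl⟩
  have hK1 : ∀ (F : EuclideanSpace ℝ (Fin 3) → EuclideanSpace ℝ (Fin 3)) (R : ℝ), YSharp a F R → XSharp a (K F) (C * R) :=
    fun F R hF => by rw [hK F]; exact (hgate α F R hF).1
  have hK2 : ∀ (F G : EuclideanSpace ℝ (Fin 3) → EuclideanSpace ℝ (Fin 3)) (s : ℝ), (∃ R, YSharp a F R) →
      (∃ R, YSharp a G R) → K (fun y => F y + s • G y) = fun y => K F y + s • K G y := by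
    intro F G s ⟨R, hF⟩ ⟨R', hG⟩
    rw [hK, hK F, hK G]
    funext y
    exact sharpGate_add_smul ha1.le hF hG s α y
  obtain ⟨F, hF, hfix⟩ := gatePerturb_exists_fixedPoint (K := K) (A := C) ha1.le hK1 hK2 hr ha2.le hV hV0 hV1 hV2 hCM
  obtain ⟨hX, hdiv, hQ1, hQb, -, heq⟩ := hgate α F (2 * ε) hF
  rw [hK F] at hfix
  refine ⟨_, _, hX.mono (le_of_eq (by ring)), hQ1, hdiv, fun y => (hQb y).trans (le_of_eq (by ring)), fun y => ?_⟩
  have hVd : DifferentiableAt ℝ V y := (hV.differentiable (by norm_num)) y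
  have h0 : lerayLin α V = lerayLin α (fun z => (fun _ => (0 : EuclideanSpace ℝ (Fin 3))) z + V z) := by simp
  rw [h0, lerayLin_add_base α (fun _ => (0 : EuclideanSpace ℝ (Fin 3))) V _ y (differentiableAt_const _) hVd, add_assoc, add_comm (fderiv ℝ _ y (V y) + _) (gradient _ y),
    ← add_assoc, heq y, hfix y]
  abel

end Summit.NavierStokesRegularity.NavierStokesRegularity.Theorems.KelvinGate

end
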